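import Summits.ABC.StewartYu.PadicLogFormsPrincipalReductionSharp
import Summits.ABC.StewartYu.GluePrincipalToPrimeGeneral
import Summits.ABC.StewartYu.KappaDoorEpsShape
import Summits.ABC.ABC.Theorems.PadicPrincipalCoreST86TheoremA
import HarnessLib

/-!
# Cell abc-stewartyu: `log c ≪_ε rad(abc)^{5/2+ε}` — the rung between `rad^{3+ε}` (M1⁺(3)) and
# `rad^{2+ε}` (M1⁺(2), open), from Theorem A₁ and the sharp principal reduction WP-M♭

`Summits/ABC/StewartYu/PadicCW77EpsShapeFiveHalves.lean` — cell `abc-stewartyu` (seat p1; theorems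
only, no definition, no named fact). Composition:

* Theorem A with `c₂ = 1` (`theoremAShapeLe_one_holds`, tree: `c₁ = 2⁷⁰`, `r = 0`;
  `Summits/ABC/ABC/Theorems/PadicPrincipalCoreST86TheoremA.lean`);
* WP-M♭ (`PrincipalLattice.exists_principal_generators_sharp`): Kummer-free principal generators
  with `∏ h(αⱼ) ≤ m^m √(m!) · p · ∏ log qᵢ` — Minkowski II in the weighted EUCLIDEAN norm, the
  Euclidean Mahler basis (nearest-plane reduction), Cauchy–Schwarz — instead of WP-M's `m^{2m}`;
* the envelope `m^m √(m!) ≤ m^{3m/2}` (`pow_mul_sqrt_factorial_le_rpow`);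
* the general glue (`primePadicBoundAt_odd_of_principal_general`, `c₄ = 3/2`): the one-prime bound
  at every odd prime with `κ = c₂ + 3/2 = 5/2`, `σ = 2`;
* the κ-door at the odd places (`KappaDoor.epsShapeBound_of_oddFinBound`, Stewart–Yu 1991 §3 with
  `n^{κn}`): `EpsShapeBound (max 1 κ)`, and `epsShapeBound_mono`.

Result: `epsShapeBound_five_halves : Literature.Barriers.ABC.EpsShapeBound (5/2)`, i.e. for every
`ε > 0` there are `κ, c₀` with `log c ≤ κ · rad(abc)^{5/2+ε}` for all abc-triples with `c ≥ c₀`.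
WHAT THIS IS NOT: not `EpsShapeBound 2` (route B₂'s WPMSharp, loss `C^m`, is open); not a route item
(the rung leaf `EpsShapeBound (5/2)` is not registered); exponential in `rad`, inside the Baker class
(`Literature.Barriers.ABC.BakerMethodBounds`), far from Stewart–Yu 1991's `rad^{2/3+ε}`.
Everything is [folklore] assembly of results PROVED in the tree.
-/

noncomputable section

open Finset
open Literature.Barriers.ABC

namespace Summit.ABC.StewartYu

/-- The envelope of WP-M♭: `m^m · √(m!) ≤ m^{3m/2}` (`m! ≤ m^m`). [folklore] -/
theorem pow_mul_sqrt_factorial_le_rpow (m : ℕ) :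
    (m : ℝ) ^ m * Real.sqrt (m.factorial) ≤ (m : ℝ) ^ ((3 / 2 : ℝ) * m) := by
  rcases Nat.eq_zero_or_pos m with hm | hm
  · subst hm; simp
  have hm0 : (0 : ℝ) < m := by exact_mod_cast hm
  have h1 : Real.sqrt (m.factorial : ℝ) ≤ (m : ℝ) ^ ((m : ℝ) / 2) := by
    calc Real.sqrt (m.factorial : ℝ) ≤ Real.sqrt ((m : ℝ) ^ m) := by
          apply Real.sqrt_le_sqrt; exact_mod_cast Nat.factorial_le_pow m
      _ = (m : ℝ) ^ ((m : ℝ) / 2) := by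
          rw [Real.sqrt_eq_rpow, ← Real.rpow_natCast, ← Real.rpow_mul hm0.le]
          congr 1; ring
  calc (m : ℝ) ^ m * Real.sqrt (m.factorial) ≤ (m : ℝ) ^ m * (m : ℝ) ^ ((m : ℝ) / 2) :=
        mul_le_mul_of_nonneg_left h1 (by positivity)
    _ = (m : ℝ) ^ ((3 / 2 : ℝ) * m) := by
        rw [← Real.rpow_natCast (m : ℝ) m, ← Real.rpow_add hm0]
        congr 1; ring

/-- **The rung `rad^{5/2+ε}` from any Theorem-A-shaped bound with envelope exponent `c₂ ≤ 1`**: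
WP-M♭ (heights `≤ m^m √(m!) p ∏ log qᵢ ≤ m^{3m/2} p ∏ log qᵢ`), the general glue with `c₄ = 3/2`
(`κ = c₂ + 3/2`, `σ = 2`), the κ-door at the odd places, and monotonicity
`max 1 (c₂ + 3/2) ≤ 5/2`. [folklore] -/
theorem epsShapeBound_five_halves_of_principal_core
    {C : ℕ → ℝ} {r : ℕ → ℕ} {c₁ c₂ : ℝ} (hc₁ : 1 ≤ c₁) (hc₂ : c₂ ≤ 1)
    (hC : ∀ m, 0 ≤ C m ∧ C m ≤ c₁ ^ m * (m : ℝ) ^ (c₂ * m))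
    (hA : ∀ (p : ℕ), p.Prime → p ≠ 2 →
      ∀ (m : ℕ) (α : Fin m → ℚ) (b : Fin m → ℤ) (V : Fin m → ℝ) (Vmax W : ℝ),
        (∀ j, α j ≠ 0 ∧ 1 ≤ padicValRat p (α j - 1)) →
        (∀ μ : Fin m → ℤ, ∏ j, α j ^ μ j = 1 → μ = 0) →
        (∀ T : Finset (Fin m), T.Nonempty → ¬ IsSquare (∏ j ∈ T, α j)) →
        (∀ j, Height.logHeight₁ (α j) ≤ V j) → (∀ j, Real.log p ≤ V j) → (∀ j, V j ≤ Vmax) →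
        b ≠ 0 → (∀ j, Real.log (max 3 (|b j| : ℝ)) ≤ W) →
        (padicValRat p (∏ j, α j ^ b j - 1) : ℝ) * Real.log p ≤
          C m * (∏ j, V j) * (W + Real.log (2 * Vmax)) * Real.log (2 * Vmax) / Real.log p ^ r m) :
    EpsShapeBound (5 / 2) := by
  have h : EpsShapeBound (max 1 (c₂ + 3 / 2)) := by
    refine KappaDoor.epsShapeBound_of_oddFinBound (K := 4704) (L := 32 * c₁) (σ := 2) (τ := 2)
      (τ₁ := 2) (by norm_num) (by linarith) (by norm_num) le_rfl ?_
    intro p hp hp2 n q e hq hinj hqp he hne1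
    exact primePadicBoundAt_odd_of_principal_general
      (A := fun m => (m : ℝ) ^ m * Real.sqrt (m.factorial)) (c₄ := 3 / 2) (by norm_num)
      pow_mul_sqrt_factorial_le_rpow PrincipalLattice.exists_principal_generators_sharp hc₁ hC hA
      hp hp2 n q e hq hinj hqp he hne1
  refine epsShapeBound_mono ?_ h
  exact max_le (by norm_num) (by linarith)

/-- **`log c ≪_ε rad(abc)^{5/2+ε}`**: for every `ε > 0` there are `κ, c₀` such that every abc-triple
with `c ≥ c₀` has `log c ≤ κ · rad(abc)^{5/2+ε}` — from Theorem A₁ (`theoremAShapeLe_one_holds`,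
`c₁ = 2⁷⁰`, `c₂ = 1`) through `epsShapeBound_five_halves_of_principal_core`. The cell's previous
kernel rungs were `rad^15` (M1) and `rad^{3+ε}` (M1⁺(3)). [folklore] -/
theorem epsShapeBound_five_halves : EpsShapeBound (5 / 2) := by
  obtain ⟨C, r, c₁, c₂, hc₁, _hc₂, hc₂1, hC, hA⟩ := theoremAShapeLe_one_holds
  exact epsShapeBound_five_halves_of_principal_core hc₁ hc₂1 hC hA

/-- **The rung leaf `EpsShapeBoundFiveHalves` HOLDS** (by-name discharge of the named statement
`Literature.Barriers.ABC.EpsShapeBoundFiveHalves := EpsShapeBound (5/2)`, rung A1.M1⁺(5/2)):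
`log c ≪_ε rad(abc)^{5/2+ε}`. [folklore] -/
theorem epsShapeBoundFiveHalves_holds : Literature.Barriers.ABC.EpsShapeBoundFiveHalves :=
  epsShapeBound_five_halves

/-- **`GlueSpecFlat` of the staged rung route `PadicPrincipalCoreRadFiveHalves` HOLDS** (its text
verbatim): WP-M♭ ∧ any Theorem-A-shaped bound with envelope `c₁^m m^{c₂ m}` ⇒ the odd one-prime bound
with `(K, L, κ) = (4704, 32c₁, c₂ + 3/2)`, `σ = τ = τ₁ = 2` — the instance `A(m) = m^m √(m!)`,
`c₄ = 3/2` of `primePadicBoundAt_odd_of_principal_general`. [folklore] -/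
theorem glueSpecFlat_holds :
    (∀ (p : ℕ), p.Prime → p ≠ 2 → ∀ (m : ℕ) (q : Fin m → ℕ), (∀ i, (q i).Prime) → Function.Injective q → (∀ i, q i ≠ p) → ∀ (e : Fin m → ℤ), e ≠ 0 → 1 ≤ padicValRat p (∏ i, (q i : ℚ) ^ e i - 1) → ∃ (α : Fin m → ℚ) (e' : Fin m → ℤ), (∀ j, α j ≠ 0 ∧ 1 ≤ padicValRat p (α j - 1)) ∧ (∀ μ : Fin m → ℤ, ∏ j, α j ^ μ j = 1 → μ = 0) ∧ (∀ T : Finset (Fin m), T.Nonempty → ¬ IsSquare (∏ j ∈ T, α j)) ∧ e' ≠ 0 ∧ ∏ i, (q i : ℚ) ^ e i = ∏ j, α j ^ e' j ∧ (∏ j, Height.logHeight₁ (α j)) ≤ (m : ℝ) ^ m * Real.sqrt (m.factorial) * p * ∏ i, Real.log (q i) ∧ (∀ j, (|e' j| : ℝ) ≤ (m : ℝ) ^ (2 * m) * p * (∏ i, Real.log (q i)) * (Finset.univ.sup fun i => (e i).natAbs)) ∧ (∀ j, Real.log p ≤ 2 * Height.logHeight₁ (α j))) → ∀ (C : ℕ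 → ℝ) (r : ℕ → ℕ) (c₁ c₂ : ℝ), 1 ≤ c₁ → 0 ≤ c₂ → (∀ m, 0 ≤ C m ∧ C m ≤ c₁ ^ m * (m : ℝ) ^ (c₂ * m)) → (∀ (p : ℕ), p.Prime → p ≠ 2 → ∀ (m : ℕ) (α : Fin m → ℚ) (b : Fin m → ℤ) (V : Fin m → ℝ) (Vmax W : ℝ), (∀ j, α j ≠ 0 ∧ 1 ≤ padicValRat p (α j - 1)) → (∀ μ : Fin m → ℤ, ∏ j, α j ^ μ j = 1 → μ = 0) → (∀ T : Finset (Fin m), T.Nonempty → ¬ IsSquare (∏ j ∈ T, α j)) → (∀ j, Height.logHeight₁ (α j) ≤ V j) → (∀ j, Real.log p ≤ V j) → (∀ j, V j ≤ Vmax) → b ≠ 0 → (∀ j, Real.log (max 3 (|b j| : ℝ)) ≤ W) → (padicValRat p (∏ j, α j ^ b j - 1) : ℝ) * Real.log p ≤ C m * (∏ j, V j) * (W + Real.log (2 * Vmax)) * Real.log (2 * Vmax) / Real.log p ^ r m) → ∃ (K L κ : ℝ), 0 ≤ K ∧ 1 ≤ L ∧ 0 ≤ κ ∧ κ ≤ c₂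 + 3 / 2 ∧ ∀ p, p.Prime → p ≠ 2 → (∀ (n : ℕ) (q : Fin n → ℕ) (e : Fin n → ℤ), (∀ i, (q i).Prime) → Function.Injective q → (∀ i, q i ≠ p) → e ≠ 0 → ∏ i, ((q i : ℚ)) ^ e i ≠ 1 → (padicValRat p (∏ i, ((q i : ℚ)) ^ e i - 1) : ℝ) ≤ K * L ^ n * (n : ℝ) ^ (κ * n) * (p : ℝ) ^ (2:ℝ) * (∏ i, Real.log (q i)) * Real.log (max 3 ((Finset.univ.sup fun i => (e i).natAbs : ℕ) : ℝ)) ^ (2:ℕ) * Real.log (max 3 (∏ i, ((q i : ℕ) : ℝ))) ^ (2:ℕ)) := by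
  intro hM C r c₁ c₂ hc₁ hc₂ hC hA
  refine ⟨4704, 32 * c₁, c₂ + 3 / 2, by norm_num, by linarith, by linarith, le_rfl, ?_⟩
  intro p hp hp2 n q e hq hinj hqp he hne1
  exact primePadicBoundAt_odd_of_principal_general
    (A := fun m => (m : ℝ) ^ m * Real.sqrt (m.factorial)) (c₄ := 3 / 2) (by norm_num)
    pow_mul_sqrt_factorial_le_rpow hM hc₁ hC hA hp hp2 n q e hq hinj hqp he hne1

end Summit.ABC.StewartYu

end
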